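import Summits.AtomisticToContinuum.FouriersLaw.Theorems.BondHeatUncertaintySubdiffusiveBondHeatKernelGibbsA
import Literature.MathematicalPhysics.KineticTheory.LangevinChainJointDensity
import Literature.MathematicalPhysics.KineticTheory.LangevinChainGibbs
import Literature.MathematicalPhysics.KineticTheory.SdeGeneratorCalculus
import Literature.Analysis.Distribution.FieldIntegrationByParts

/-!
# The Gibbs transpose of the Langevin generator: `Lᵀ(e^{-H/T} g) = e^{-H/T} · (L(g∘Θ))∘Θ`

Helper file for item stmt-AtomisticToContinuum-9144 (`ResponseDensity`, route
`OddSectorIrreversibility`, sub-problem `FouriersLaw` of `AtomisticToContinuum`), second step towards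
the detailed balance of the equilibrium kernels (hypothesis `hDUAL` of the conditional reduction).
For an oscillator chain with smooth potentials, both baths at temperature `T > 0`, generator `L`
(3.2), reversed generator `L̂ = sdeGenerator (-Y) v_L v_R`, Gibbs weight `π = e^{-H/T}` and momentum
flip `Θ(q, p) = (q, -p)`:

* `langevin_fokkerPlanck_apply` — the Fokker–Planck operator `L* = ∑_b X_b² - Y + 2γ` in Hörmander's
  form is `L̂ + 2γ` on smooth functions;
* `langevin_integral_revGenerator_mul` — `∫ (L̂ f + 2γ f) g dx = ∫ f (L g) dx` for `f ∈ C_c^∞`,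
  `g ∈ C^∞` (the tree's `integral_hormanderOp_mul` and `hormanderTranspose_eq_generator`);
* `langevin_drift_momentumFlip`, `langevin_generator_comp_momentumFlip` — `Θ Y Θ = -Y - 2γ Γp` and
  the conjugated generator `(L(g∘Θ))(Θx) = L̂ g(x) - 2γ ∑_b p_b ∂_{p_b} g(x)`;
* `langevin_revGenerator_gibbsDensity_mul` — **the Gibbs transpose identity**
  `L̂(πg) + 2γ πg = π · (L(g∘Θ))∘Θ` (pointwise, smooth `g`);
* `langevin_integral_gibbs_mul_generator` — **`∫ π g₁ (L g₂) dx = ∫ π (L(g₁∘Θ))∘Θ g₂ dx`** for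
  `g₁ ∈ C_c^∞`, `g₂ ∈ C^∞` (generalised detailed balance at the level of the generator);
* `langevin_integral_gibbs_generator`, `langevin_integral_gibbs_generator_mul_add` — `∫ π L f dx = 0`
  for `f ∈ C_c^∞` and the polarised form `∫ π (f Lg + g Lf + Γ(f, g)) dx = 0` (`fg ∈ C_c^∞`).

No definitions.
-/

noncomputable section

open MeasureTheory ProbabilityTheory Filter Topology Set Function
open scoped NNReal ENNReal ContDiff

namespace Summit.AtomisticToContinuum.FouriersLaw.Theorems

open Literature.MathematicalPhysics.KineticTheory.HeatConduction
open Literature.Probability.Process Literature.MathematicalPhysics.KineticTheory OscillatorChain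
open Literature.Analysis.Distribution

variable {N : ℕ}

section General

variable (P : OscillatorChain) (hU : ContDiff ℝ ∞ P.U) (hV : ContDiff ℝ ∞ P.V) (hN : 0 < N)

/-- **The Fokker–Planck operator in Hörmander's form is `L̂ + 2γ`**:
`(∑_b X_b² - Y + 2γ) h = L̂ h + 2γ h` on smooth `h` (`L̂ = sdeGenerator (-Y) v_L v_R`). -/
theorem langevin_fokkerPlanck_apply {T_L T_R : ℝ} (hL : 0 ≤ P.γ * T_L) (hR : 0 ≤ P.γ * T_R)
    {h : PhaseSpace N → ℝ} (hh : ContDiff ℝ ∞ h) (x : PhaseSpace N) :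
    hormanderOp (P.adjointDrift N) (P.bathField hN T_L T_R) (fun _ => 2 * P.γ) h x =
      sdeGenerator (fun y => -P.drift N y) (P.bathVecL N T_L) (P.bathVecR N T_R) h x + 2 * P.γ * h x := by
  rw [hormanderOp, P.sdeGenerator_neg_drift_eq hN hL hR hh x]
  simp only [fieldDeriv, OscillatorChain.adjointDrift, map_neg]
  ring

include hU hV hN in
/-- **`∫ (L̂ f + 2γ f) g dx = ∫ f (L g) dx`** for `f ∈ C_c^∞` and `g ∈ C^∞`: the generator is the
formal transpose of the Fokker–Planck operator (`integral_hormanderOp_mul`,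
`hormanderTranspose_eq_generator`). -/
theorem langevin_integral_revGenerator_mul {T_L T_R : ℝ} (hL : 0 ≤ P.γ * T_L) (hR : 0 ≤ P.γ * T_R)
    {f g : PhaseSpace N → ℝ} (hf : ContDiff ℝ ∞ f) (hfc : HasCompactSupport f) (hg : ContDiff ℝ ∞ g) :
    ∫ x, (sdeGenerator (fun y => -P.drift N y) (P.bathVecL N T_L) (P.bathVecR N T_R) f x + 2 * P.γ * f x) *
        g x =
      ∫ x, f x * P.generator N T_L T_R g x := by
  haveI := isAddHaarMeasure_volume_phaseSpace N
  have hX₀ : ContDiff ℝ ∞ (P.adjointDrift N) := (P.contDiff_drift hU hV N).neg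
  have hX : ∀ b, ContDiff ℝ ∞ (P.bathField hN T_L T_R b) := fun b => contDiff_const
  have h := integral_hormanderOp_mul (μ := (volume : Measure (PhaseSpace N))) (c := fun _ => 2 * P.γ)
    hX₀ hX contDiff_const hf hg hfc
  rw [P.hormanderTranspose_eq_generator hU hV hN hL hR hg] at h
  rw [← h]
  refine integral_congr_ae (Eventually.of_forall fun x => ?_)
  simp only [langevin_fokkerPlanck_apply P hN hL hR hf x]

end General

section Flip

variable (P : OscillatorChain) (hU : ContDiff ℝ ∞ P.U) (hV : ContDiff ℝ ∞ P.V) (hN : 0 < N)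
  (hγ : 0 ≤ P.γ) {T : ℝ} (hT : 0 < T)
include hU hV hN hT

include hγ in
/-- **`Θ Y Θ = -Y - 2γ Γp`**, written with the bath vectors: for `c = √(2γT)`,
`Θ(Y(Θx)) = -Y(x) - ((c p_0/T) v_L + (c p_{N-1}/T) v_R)` (`c v_b = c² ∂_{p_b} = 2γT ∂_{p_b}`). -/
theorem langevin_drift_momentumFlip (x : PhaseSpace N) :
    (((P.drift N (x.1, -x.2)).1, -(P.drift N (x.1, -x.2)).2) : PhaseSpace N) =
      -P.drift N x -
        ((Real.sqrt (2 * P.γ * T) * x.2 ⟨0, hN⟩ / T) • P.bathVecL N T +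
          (Real.sqrt (2 * P.γ * T) * x.2 ⟨N - 1, by omega⟩ / T) • P.bathVecR N T) := by
  have hγT2 : 0 ≤ 2 * P.γ * T := by nlinarith [mul_nonneg hγ hT.le]
  set c : ℝ := Real.sqrt (2 * P.γ * T) with hc
  have hc2 : c * c = 2 * P.γ * T := Real.mul_self_sqrt hγT2
  have hT0 : T ≠ 0 := hT.ne'
  have hcc : ∀ r : ℝ, c * r / T * c = 2 * P.γ * r := fun r => by
    rw [show c * r / T * c = (c * c) * r / T by ring, hc2]
    field_simp
  have hUd : Differentiable ℝ P.U := hU.differentiable (by simp)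
  have hVd : Differentiable ℝ P.V := hV.differentiable (by simp)
  have hvL : P.bathVecL N T = ((0 : Fin N → ℝ), fun i : Fin N => if i.val = 0 then c else 0) := rfl
  have hvR : P.bathVecR N T = ((0 : Fin N → ℝ), fun i : Fin N => if i.val = N - 1 then c else 0) := rfl
  rw [P.drift_eq hUd hVd N, hvL, hvR]
  refine Prod.ext ?_ ?_
  · simp
  · funext i
    simp only [Prod.snd_neg, Prod.snd_sub, Prod.snd_add, Prod.smul_mk, Pi.neg_apply, Pi.sub_apply,
      Pi.add_apply, Pi.smul_apply, smul_eq_mul, mul_ite, mul_zero, bathWeight]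
    by_cases h0 : i.val = 0
    · have e0 : (⟨0, hN⟩ : Fin N) = i := Fin.ext h0.symm
      by_cases h1 : i.val = N - 1
      · have e1 : (⟨N - 1, by omega⟩ : Fin N) = i := Fin.ext h1.symm
        rw [if_pos h0, if_pos h1, if_pos h0, if_pos h1, e0, e1, hcc]
        ring
      · rw [if_pos h0, if_neg h1, if_pos h0, if_neg h1, e0, hcc]
        ring
    · by_cases h1 : i.val = N - 1
      · have e1 : (⟨N - 1, by omega⟩ : Fin N) = i := Fin.ext h1.symm
        rw [if_neg h0, if_pos h1, if_neg h0, if_pos h1, e1, hcc]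
        ring
      · rw [if_neg h0, if_neg h1, if_neg h0, if_neg h1]
        ring

include hγ in
/-- **The conjugated generator**: for `g ∈ C²` and `c = √(2γT)`,
`(L(g∘Θ))(Θx) = L̂ g(x) - ((c p_0/T) Dg(x)·v_L + (c p_{N-1}/T) Dg(x)·v_R)`. -/
theorem langevin_generator_comp_momentumFlip {g : PhaseSpace N → ℝ} (hg : ContDiff ℝ 2 g)
    (x : PhaseSpace N) :
    P.generator N T T (fun y => g (y.1, -y.2)) (x.1, -x.2) =
      sdeGenerator (fun y => -P.drift N y) (P.bathVecL N T) (P.bathVecR N T) g x -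
        ((Real.sqrt (2 * P.γ * T) * x.2 ⟨0, hN⟩ / T) * fderiv ℝ g x (P.bathVecL N T) +
          (Real.sqrt (2 * P.γ * T) * x.2 ⟨N - 1, by omega⟩ / T) * fderiv ℝ g x (P.bathVecR N T)) := by
  have hγT : 0 ≤ P.γ * T := mul_nonneg hγ hT.le
  -- the momentum flip as a continuous linear map
  set A : PhaseSpace N →L[ℝ] PhaseSpace N :=
    (ContinuousLinearMap.id ℝ (Fin N → ℝ)).prodMap (-(ContinuousLinearMap.id ℝ (Fin N → ℝ))) with hA_def
  have hA : ∀ y : PhaseSpace N, A y = (y.1, -y.2) := fun y => by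
    simp [hA_def, Prod.map]
  have hgA : (fun y : PhaseSpace N => g (y.1, -y.2)) = fun y => g (A y) := by
    funext y; rw [hA]
  have hgΘ : ContDiff ℝ 2 fun y : PhaseSpace N => g (y.1, -y.2) := by
    rw [hgA]; exact hg.comp A.contDiff
  rw [← P.sdeGenerator_drift_eq_generator hN hγT hγT hgΘ, hgA,
    sdeGenerator_comp_clm (P.drift N) (P.bathVecL N T) (P.bathVecR N T) A hg (x.1, -x.2)]
  have hAx : A (x.1, -x.2) = x := by rw [hA]; simp
  have hAL : A (P.bathVecL N T) = -P.bathVecL N T := by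
    rw [hA]; simp [OscillatorChain.bathVecL, bathVec]
  have hAR : A (P.bathVecR N T) = -P.bathVecR N T := by
    rw [hA]; simp [OscillatorChain.bathVecR, bathVec]
  have hAY : A (P.drift N (x.1, -x.2)) = -P.drift N x -
      ((Real.sqrt (2 * P.γ * T) * x.2 ⟨0, hN⟩ / T) • P.bathVecL N T +
        (Real.sqrt (2 * P.γ * T) * x.2 ⟨N - 1, by omega⟩ / T) • P.bathVecR N T) := by
    rw [hA]; exact langevin_drift_momentumFlip P hU hV hN hγ hT x
  rw [hAx, hAL, hAR, hAY, sdeGenerator_def]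
  simp only [map_neg, map_sub, map_add, map_smul, neg_apply, neg_neg, smul_eq_mul]
  ring

omit hN hT in
/-- The carré du champ against the Gibbs weight: `Γ(π, g) = -(π/T) ∑_b (DH·v_b)(Dg·v_b)`. -/
theorem langevin_carreDuChamp_gibbsDensity (g : PhaseSpace N → ℝ) (x : PhaseSpace N) :
    carreDuChamp (P.bathVecL N T) (P.bathVecR N T) (P.gibbsDensity N T) g x =
      -(P.gibbsDensity N T x / T) *
        (fderiv ℝ (P.hamiltonian N) x (P.bathVecL N T) * fderiv ℝ g x (P.bathVecL N T) +
          fderiv ℝ (P.hamiltonian N) x (P.bathVecR N T) * fderiv ℝ g x (P.bathVecR N T)) := by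
  have hH : Differentiable ℝ (P.hamiltonian N) :=
    (P.contDiff_hamiltonian hU hV N).differentiable (by simp)
  have e : P.gibbsDensity N T = fun y => Real.exp (-1 / T * P.hamiltonian N y) := by
    funext y; simp only [OscillatorChain.gibbsDensity]; congr 1; ring
  have hd : fderiv ℝ (P.gibbsDensity N T) x =
      (Real.exp (-1 / T * P.hamiltonian N x) * (-1 / T)) • fderiv ℝ (P.hamiltonian N) x := by
    rw [e]
    have h1 := ((hH x).hasFDerivAt.const_mul (-1 / T)).exp
    rw [h1.fderiv, smul_smul]
  rw [carreDuChamp_def, hd]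
  simp only [FunLike.coe_smul, Pi.smul_apply, smul_eq_mul, e]
  ring

include hγ in
/-- **The Gibbs transpose identity** `L̂(πg) + 2γ πg = π · (L(g∘Θ))∘Θ` for smooth `g`
(`π = e^{-H/T}`, both baths at `T`): product rule for `L̂`, `L̂π = -2γπ`
(`revGenerator_gibbsDensity`), `Γ(π, g) = -(π/T) ∑_b c p_b Dg·v_b`, and the conjugated generator. -/
theorem langevin_revGenerator_gibbsDensity_mul {g : PhaseSpace N → ℝ} (hg : ContDiff ℝ ∞ g)
    (x : PhaseSpace N) :
    sdeGenerator (fun y => -P.drift N y) (P.bathVecL N T) (P.bathVecR N T)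
          (fun y => P.gibbsDensity N T y * g y) x +
        2 * P.γ * (P.gibbsDensity N T x * g x) =
      P.gibbsDensity N T x * P.generator N T T (fun y => g (y.1, -y.2)) (x.1, -x.2) := by
  have hU2 : ContDiff ℝ 2 P.U := hU.of_le (by norm_cast)
  have hV2 : ContDiff ℝ 2 P.V := hV.of_le (by norm_cast)
  have hg2 : ContDiff ℝ 2 g := hg.of_le (by norm_cast)
  have hH : Differentiable ℝ (P.hamiltonian N) :=
    (P.contDiff_hamiltonian hU hV N).differentiable (by simp)
  have hπ2 : ContDiff ℝ 2 (P.gibbsDensity N T) := by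
    have h : P.gibbsDensity N T = fun y => Real.exp (-P.hamiltonian N y / T) := rfl
    rw [h]
    exact Real.contDiff_exp.comp ((P.contDiff_hamiltonian hU2 hV2 N).neg.div_const T)
  rw [sdeGenerator_mul' _ _ _ hπ2 hg2 x, SubdiffusiveBondHeat.revGenerator_gibbsDensity hU2 hV2 hN hγ hT x,
    langevin_generator_comp_momentumFlip P hU hV hN hγ hT hg2 x,
    langevin_carreDuChamp_gibbsDensity P hU hV g x]
  have hL : fderiv ℝ (P.hamiltonian N) x (P.bathVecL N T) = Real.sqrt (2 * P.γ * T) * x.2 ⟨0, hN⟩ :=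
    SubdiffusiveBondHeat.fderiv_hamiltonian_bathVec P hH x hN _
  have hR : fderiv ℝ (P.hamiltonian N) x (P.bathVecR N T) =
      Real.sqrt (2 * P.γ * T) * x.2 ⟨N - 1, by omega⟩ :=
    SubdiffusiveBondHeat.fderiv_hamiltonian_bathVec P hH x (by omega) _
  rw [hL, hR]
  ring

include hγ in
/-- **Generalised detailed balance at the level of the generator**:
`∫ π g₁ (L g₂) dx = ∫ π · (L(g₁∘Θ))∘Θ · g₂ dx` for `g₁ ∈ C_c^∞`, `g₂ ∈ C^∞`. -/
theorem langevin_integral_gibbs_mul_generator {g₁ g₂ : PhaseSpace N → ℝ} (hg₁ : ContDiff ℝ ∞ g₁)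
    (hg₁c : HasCompactSupport g₁) (hg₂ : ContDiff ℝ ∞ g₂) :
    ∫ x, P.gibbsDensity N T x * g₁ x * P.generator N T T g₂ x =
      ∫ x, P.gibbsDensity N T x * P.generator N T T (fun y => g₁ (y.1, -y.2)) (x.1, -x.2) * g₂ x := by
  have hγT : 0 ≤ P.γ * T := mul_nonneg hγ hT.le
  have hπ : ContDiff ℝ ∞ (P.gibbsDensity N T) := by
    have h : P.gibbsDensity N T = fun y => Real.exp (-P.hamiltonian N y / T) := rfl
    rw [h]
    exact Real.contDiff_exp.comp ((P.contDiff_hamiltonian hU hV N).neg.div_const T)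
  have h := langevin_integral_revGenerator_mul P hU hV hN hγT hγT (hπ.mul hg₁) (hg₁c.mul_left) hg₂
  rw [← h]
  exact integral_congr_ae (Eventually.of_forall fun x => by
    simp only
    rw [langevin_revGenerator_gibbsDensity_mul P hU hV hN hγ hT hg₁ x])

include hγ in
/-- **`∫ π L f dx = 0` for `f ∈ C_c^∞`** (the Gibbs density is infinitesimally invariant). -/
theorem langevin_integral_gibbs_generator {f : PhaseSpace N → ℝ} (hf : ContDiff ℝ ∞ f)
    (hfc : HasCompactSupport f) :
    ∫ x, P.gibbsDensity N T x * P.generator N T T f x = 0 := by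
  -- apply the transpose identity to `f ∘ Θ` against the constant `1`
  set A : PhaseSpace N →L[ℝ] PhaseSpace N :=
    (ContinuousLinearMap.id ℝ (Fin N → ℝ)).prodMap (-(ContinuousLinearMap.id ℝ (Fin N → ℝ))) with hA_def
  have hA : ∀ y : PhaseSpace N, A y = (y.1, -y.2) := fun y => by
    simp [hA_def, Prod.map]
  have hfΘ : ContDiff ℝ ∞ fun y : PhaseSpace N => f (y.1, -y.2) := by
    have e : (fun y : PhaseSpace N => f (y.1, -y.2)) = fun y => f (A y) := by funext y; rw [hA]
    rw [e]; exact hf.comp A.contDiff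
  have hfΘc : HasCompactSupport fun y : PhaseSpace N => f (y.1, -y.2) := by
    have e : (fun y : PhaseSpace N => f (y.1, -y.2)) = f ∘ (momentumReversal N) := by
      funext y; simp
    rw [e]
    exact hfc.comp_homeomorph ((Homeomorph.refl (Fin N → ℝ)).prodCongr (Homeomorph.neg (Fin N → ℝ)))
  have h := langevin_integral_gibbs_mul_generator P hU hV hN hγ hT hfΘ hfΘc (contDiff_const (c := (1 : ℝ)))
  simp only [P.generator_const, mul_zero, integral_zero, neg_neg, mul_one] at h
  -- `h : 0 = ∫ π(x) (L f)(Θx)`; flip the momenta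
  have hflip := integral_comp_momentumReversal N fun x => P.gibbsDensity N T x * P.generator N T T f x
  simp only [OscillatorChain.gibbsDensity, P.hamiltonian_neg_momentum] at hflip h
  simp only [OscillatorChain.gibbsDensity]
  rw [← hflip]
  exact h.symm

include hγ in
/-- **The polarised identity** `∫ π (f Lg + g Lf + Γ(f, g)) dx = 0` for smooth `f, g` with
`f` compactly supported (`L(fg) = f Lg + g Lf + Γ(f,g)`, `fg ∈ C_c^∞`). -/
theorem langevin_integral_gibbs_generator_mul_add {f g : PhaseSpace N → ℝ} (hf : ContDiff ℝ ∞ f)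
    (hfc : HasCompactSupport f) (hg : ContDiff ℝ ∞ g) :
    ∫ x, P.gibbsDensity N T x * (f x * P.generator N T T g x + g x * P.generator N T T f x +
      carreDuChamp (P.bathVecL N T) (P.bathVecR N T) f g x) = 0 := by
  have hγT : 0 ≤ P.γ * T := mul_nonneg hγ hT.le
  have hf2 : ContDiff ℝ 2 f := hf.of_le (by norm_cast)
  have hg2 : ContDiff ℝ 2 g := hg.of_le (by norm_cast)
  have h := langevin_integral_gibbs_generator P hU hV hN hγ hT (hf.mul hg) (hfc.mul_right)
  rw [← h]
  refine integral_congr_ae (Eventually.of_forall fun x => ?_)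
  simp only
  rw [← P.sdeGenerator_drift_eq_generator hN hγT hγT (hf2.mul hg2),
    ← P.sdeGenerator_drift_eq_generator hN hγT hγT hf2, ← P.sdeGenerator_drift_eq_generator hN hγT hγT hg2,
    sdeGenerator_mul' _ _ _ hf2 hg2 x]

end Flip

end Summit.AtomisticToContinuum.FouriersLaw.Theorems

end
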